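import Literature.Geometry.Kaehler.ComplexTorusComplementaryMultidegrees
import Literature.Geometry.Kaehler.ComplexTorusComplementaryRestrictedPolarizations
import HarnessLib

/-!
# Dual subtori for an ARBITRARY polarisation: `η♭([B]) = ± |K(λ) ∩ B| · cl(B^⊥)`
# (Bertrand 1997, §1 Prop. 1 (i), §3 Thm. 3 (i) — the multiplicity `|B′/B^⊥| = |K(λ)|/|B^⊥ ∩ K(λ)| = |B ∩ K(λ)|`)

Layer `Literature/Geometry/Kaehler`, namespace `Literature.Geometry.Kaehler.ComplexTorus`; lane `lit-hodgefound`
(Track 2 foundations library, Layers A2/A4), prover seat p09 (gen 15, self-proposed row g15-#3).  Theorems only.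
Sequel of `ComplexTorusComplementarySubtorusClassDuality.lean` (gen 11: the PRINCIPAL case `cl(B^⊥) = ± η♭([B])`,
`IsPrincipalPolarization.cycleFormOfFrame_orthSubspace_eq_smul_polFlat`, whose header leaves "TODO(general form):
Prop. 1 (i)–(ii) on forms for a non-unimodular `L` (the counts are the tree's `natCard_subK_mul_natCard_subK`,
`natCard_kerPhiH_eq_mul` of `ComplexTorusComplementaryRestrictedPolarizations`)" — done here), of
`ComplexTorusComplementaryRestrictedPolarizations.lean` (p10: (2.17) `|K(L_B)| = |B ∩ P| · |K(L) ∩ B|`,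
`natCard_subK_eq_mul`, consumed by name) and of `ComplexTorusComplementaryMultidegrees.lean` (gen 15: the complementary
multidegree identity on forms for all types, specialised in §3 to the subvarieties).

## Source, verbatim

D. Bertrand, *Duality on tori and multiplicative dependence relations*, J. Austral. Math. Soc. (Series A) **62**
(1997) 198–216 [cite: Bertrand1997DualityTori] (held text `paper:doi-10-1017-s1446788700000768`; chunk = PDF page):

* §1 (b) PROPOSITION 1, pp. 200–201 [p0003–p0004]: "Let `b` be a non-degenerate symmetric or antisymmetric
  bilinear form on a finite-dimensional real vector space `V`, assuming integral values on a lattice `L` in `V`.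
  Let further `M` be a primitive subgroup of `L`, cut out by a regular `ℝ`-subspace `W` of `V`, and let `M^⊥` be the
  primitive subgroup of `L` cut out by the orthogonal complement `W^⊥` of `W` in `V`. Then: (i) …
  `[L^* : M ⊕ M^⊥] = [(M^⊥)^* : M^⊥]·[W ∩ L^* : M] = [M^* : M]·[W^⊥ ∩ L^* : M^⊥]`"; §1 (a), p. 200: "`[M^* : M] =
  Vol(M)/Vol(M^*) = Vol(M)²`" (`Vol(M)²` = the absolute value of `det (b(mᵢ, mⱼ))`).
* §3 (a) THEOREM 3 (i), p. 212 [p0015]: "the degree `|B ∩ B^⊥|` of the isogeny `σ : B × B^⊥ → A` satisfies the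
  formula: `|B ∩ B^⊥|·|K(λ)| = (deg_λ(B)/b!)²·|B^⊥ ∩ K(λ)| = (deg_λ(B^⊥)/b′!)²·|B ∩ K(λ)|`", PROOF: "The restriction
  of `λ` to `B` is again a polarisation of `B`, whose associated isogeny from `B` to `B^∨` is given by `j^∨ ∘ φ ∘ j`.
  By Riemann–Roch on `B` and the definition of `B′` [`= φ⁻¹(Ker j′^∨)`, with identity component `B^⊥`], we therefore
  have: `(deg_λ(B)/b!)² = |B ∩ B′|`.  Since the cycle associated to `B′` is equal to `{|B′/B^⊥| =
  |K(λ)/(B^⊥ ∩ K(λ))| = } |K(λ)|/|B^⊥ ∩ K(λ)|` times that of `B^⊥`, this last expression is also equal to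
  `|B ∩ B^⊥|·|K(λ)|/|B^⊥ ∩ K(λ)|`, and our first formulae follow by biorthogonality."; (ii): "in particular,
  `|K(λ)| = |B ∩ K(λ)|·|B^⊥ ∩ K(λ)|`" (so that the multiplicity `|B′/B^⊥|` is `|B ∩ K(λ)|`); p. 199: "Over `ℂ`,
  this boils down to the study of dual subtori in `(ℝ/ℤ)^{2n}`".

## Dictionary and what is proved (theorems only; no definition, no named fact)

As in gen 11's file: `V_ℝ = Λ ⊗ ℝ = ℝ^ι`, `L = Λ`, `b = η` a Riemann form (ANY polarisation; integer Gram matrix `G`,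
`hG`; `K(λ) = kerPhiH Φ G`); `W = V` a complex lattice subspace, `M = Λ ∩ V` with adapted basis `u = λ ∘ eV` (`a = rk M`),
`B = Y = π(ΦV)` (`subtorus Φ V`); `W^⊥ = V^⊥ = orthSubspace Φ η V`, `M^⊥ = Λ ∩ V^⊥` with adapted basis `w`
(`b = rk M^⊥`), `B^⊥ = Z = π(ΦV^⊥)`; `[M^* : M] = |K(ι_Y^*L)| = Nat.card (subK Φ η V)`; `[Y] = u₀ ⋆ ⋯ ⋆ u_{a-1} ∈
H_a(X, ℤ) = ⋀^a Λ`; `cl(Z) = [Z_w] = (Φw) ⌟ vol` (`cycleFormOfFrame`, `SubtorusFrame.cycleForm`); `η♭ = polFlat Φ η`.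

* §1 **`IsRiemannForm.natCard_smul_cycleFormOfFrame_orthSubspace_eq_smul_polFlat` — THE DUALITY THEOREM FOR AN
  ARBITRARY POLARISATION: `|K(λ) ∩ Y| · cl(Z) = sign_Z(eW) · sign_Y(eV) · η♭([Y])`.**  PROOF (gen 11's, with the
  general count): both sides are alternating `a`-forms, compared on the sub-families of the real basis `Φw ⊔ Φu`;
  a family through some `Φwⱼ` kills both (`M ⟂ M^⊥`); on `Φu`: `[Z_w](Φu) = vol(Φw ⊔ Φu) = ± |Z ∩ Y|` (Bézout,
  tree `torusIntegral_cycleForm_wedge_cycleForm_eq_sign_mul_natCard`) while `η♭([Y])(Φu) = det B(M) = [M^* : M]`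
  (`IsRiemannForm.det_gram_adaptedBasis_eq_natCard_subK`) `= |Y ∩ Z| · |K(λ) ∩ Y|` — Prop. 1 (i) in the form (2.17)
  `|K(L_B)| = |B ∩ P| · |K(L) ∩ B|` (`natCard_subK_eq_mul`).  Solved and oriented forms:
  `IsRiemannForm.polFlat_eq_smul_cycleFormOfFrame_orthSubspace` (`η♭([Y]) = ± |K(λ) ∩ Y| · cl(Z)`),
  `IsRiemannForm.polFlat_eq_natCard_smul_cycleFormOfFrame_orthSubspace` (complex orientations, no sign), the pair
  form `…_of_orthSubspace_eq` and the mirror `IsRiemannForm.natCard_smul_cycleFormOfFrame_eq_smul_polFlat_orthSubspace`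
  (`|K(λ) ∩ Z| · cl(Y) = ± η♭([Z])`).
* §2 `IsRiemannForm.polFlat_eq_natCard_smul_cycleForm_of_realSpan_eq` — **`η♭([Y]) = |K(λ) ∩ Y| · cl(Z)` for
  ARBITRARY subtorus data** presenting `Y`, `Z` (tree `SubtorusFrame.cycleForm_eq_of_realSpan_eq`,
  `SubtorusFrame.ιMulti_frame_eq_of_realSpan_eq`); the integrals `IsRiemannForm.torusIntegral_wedge_polFlat`
  (`∫_X θ ∧ η♭([Y]) = ± |K(λ) ∩ Y| · θ(Φw)`), `…_eq_natCard_mul_cycleIntegral` (`= |K(λ) ∩ Y| · ∫_{[Z]} θ`),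
  `…_of_realSpan_eq` (`= |K(λ) ∩ Y| · ∫_X θ ∧ cl(Z)`); and `IsPrincipalPolarization.natCard_kerPhiH_inf_subtorus_eq_one`
  (a principal `λ` has multiplicity `|K(λ) ∩ Y| = 1`: §1 then reads as gen 11's theorem).
* §3 `IsSymplecticEnum.prod_factorial_mul_natCard_mul_torusIntegral_chern_wedge_cycleForm_orthSubspace` — with gen 15's
  multidegree identity for all types: **`J! · |K(λ) ∩ B| · ∫_X ch^{J′} ∧ cl(B^⊥) = (d₁⋯d_g) · J′! · ∫_X ch^{J} ∧ cl(B)`**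
  for a symplectic basis of type `(d₁, …, d_g)` split into blocks and complementary words `J = J(c)`, `J′ = J(c′)`;
  one block gives Thm. 3 (ii)'s `deg_λ(B^⊥) = (b′!/a!b!) deg_λ(B) deg_λ(A)/|B ∩ K(λ)|` (`deg_λ(A) = a!·d₁⋯d_g`; the
  tree's `IsRiemannForm.degree_orthSubspace_eq`, p10), a principal `λ` gives the §3 (b) COROLLARY.

## References

* [Bertrand1997DualityTori] D. Bertrand, *Duality on tori and multiplicative dependence relations*, J. Austral.
  Math. Soc. Ser. A 62 (1997) 198–216, doi:10.1017/S1446788700000768, §1 (a)–(b) Prop. 1 (pp. 199–201), §3 (a)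
  Thm. 3 (i)–(ii) and proof (p. 212), §3 (b) Corollary (p. 214).
* [LangeRodriguez2022] H. Lange, R. E. Rodríguez, *Decomposition of Jacobians by Prym Varieties*, LNM 2310 (2022),
  §2.6.2 (2.17) and Thm. 2.6.10, p. 37.
* [Lange2023AbelianVarietiesComplex] H. Lange, *Abelian Varieties over the Complex Numbers*, Springer (2023), §2.5.3
  Lemma 2.5.12 / 2.5.14, §5.3.1 Cor. 5.3.4, §6.2.1.
-/

noncomputable section

open Module Function
open Literature.LinearAlgebra.Alternating

namespace Literature.Geometry.Kaehler

namespace ComplexTorus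

/-! ## §1 The duality theorem for an arbitrary polarisation: `|K(L) ∩ Y| · cl(Y^⊥) = ± η♭([Y])` -/

section Duality

variable {ι : Type*} [Fintype ι] [DecidableEq ι] {E : Type*} [NormedAddCommGroup E] [NormedSpace ℂ E]
  (Φ : (ι → ℝ) ≃L[ℝ] E) {η : E [⋀^Fin 2]→L[ℝ] ℝ} {G : Matrix ι ι ℤ} {V : Submodule ℝ (ι → ℝ)} {a b : ℕ}

/-- **THE DUALITY THEOREM FOR AN ARBITRARY POLARISATION: `|K(λ) ∩ B| · cl(B^⊥) = ± η♭([B])`.**  Let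
`(X = E/ΦΛ, η)` be a polarised torus (ANY polarisation; integer Gram matrix `G`, `K(λ) = kerPhiH Φ G`), `Y = π(ΦV)`
a complex sub-torus (lattice `M = Λ ∩ V` of rank `a`, adapted basis `u = λ ∘ eV`) and `Z = Y^⊥ = π(ΦV^⊥)` its
complementary sub-torus (lattice `M^⊥ = Λ ∩ V^⊥` of rank `b`, adapted basis `w`, `a + b = rk Λ`).  Then
`|K(λ) ∩ Y| · [Z_w] = sign_Z(eW) · sign_Y(eV) · η♭([Y])` in `Hᵃ(X, ℂ)`: the polarisation dual of the fundamental
class of `Y` is `|K(λ) ∩ Y|` times the class of the complementary subvariety (Bertrand, proof of Thm. 3 (i): "the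
cycle associated to `B′` is equal to `|K(λ)|/|B^⊥ ∩ K(λ)|` times that of `B^⊥`", and `|K(λ)|/|B^⊥ ∩ K(λ)| =
|B ∩ K(λ)|` by Thm. 3 (ii); for a principal `λ` this is the tree's `cycleFormOfFrame_orthSubspace_eq_smul_polFlat`).
PROOF, as in the principal case (both sides are alternating `a`-forms compared on the sub-families of the real
basis `Φw ⊔ Φu`; a family through some `Φwⱼ` kills both), with the general count on `Φu`:
`[Z_w](Φu) = vol(Φw ⊔ Φu) = ± |Z ∩ Y|` (Bézout) while `η♭([Y])(Φu) = det B(M) = [M^* : M] = |K(ι_Y^*L)| =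
|Y ∩ Z| · |K(λ) ∩ Y|` — Bertrand's Prop. 1 (i) "`[L^* : M ⊕ M^⊥] = [M^* : M]·[W^⊥ ∩ L^* : M^⊥]`" in the form
(2.17) of Lange–Rodríguez, the tree's `natCard_subK_eq_mul`.
[cite: Bertrand1997DualityTori, §1 (b) Prop. 1 (i) (pp. 200–201) and §3 (a) Thm. 3 (i), proof (p. 212)]
[cite: LangeRodriguez2022, §2.6.2 (2.17), p. 37] -/
theorem IsRiemannForm.natCard_smul_cycleFormOfFrame_orthSubspace_eq_smul_polFlat (hη : IsRiemannForm Φ η)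
    (hG : G.map (Int.cast : ℤ → ℝ) = latticeGram Φ η) (hV : IsLatticeSubspace V) (hVc : IsComplexSubspace Φ V)
    (hW : IsLatticeSubspace (orthSubspace Φ η V)) (hWc : IsComplexSubspace Φ (orthSubspace Φ η V))
    (e : Fin (b + a) ≃ ι) (eV : Fin a ≃ Fin (subRank V)) (eW : Fin b ≃ Fin (subRank (orthSubspace Φ η V))) :
    (Nat.card ↥(kerPhiH Φ G ⊓ subtorus Φ V) : ℂ) •
        cycleFormOfFrame Φ e (fun j ↦ adaptedBasis (orthSubspace Φ η V) (adaptedEmb _ (eW j))) =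
      ((orientationSign (subtorusPeriod Φ (orthSubspace Φ η V) hW hWc) eW *
          orientationSign (subtorusPeriod Φ V hV hVc) eV : ℤ) : ℂ) •
        polFlat Φ η a (exteriorPower.ιMulti ℤ a fun i ↦ adaptedBasis V (adaptedEmb V (eV i))) := by
  set u : Fin a → (ι → ℤ) := fun i ↦ adaptedBasis V (adaptedEmb V (eV i)) with hudef
  set w : Fin b → (ι → ℤ) := fun j ↦ adaptedBasis (orthSubspace Φ η V) (adaptedEmb _ (eW j)) with hwdef
  have hu : ∀ i, intVec (u i) ∈ V := fun i ↦ (mem_subLattice_iff).1 (adaptedBasis_adaptedEmb_mem V (eV i))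
  have hw : ∀ j, intVec (w j) ∈ orthSubspace Φ η V := fun j ↦
    (mem_subLattice_iff).1 (adaptedBasis_adaptedEmb_mem (orthSubspace Φ η V) (eW j))
  -- permutations act on continuous alternating maps through the sign
  have hperm : ∀ (f : E [⋀^Fin a]→L[ℝ] ℂ) (x : Fin a → E) (σ : Equiv.Perm (Fin a)),
      f (x ∘ σ) = Equiv.Perm.sign σ • f x := fun f x σ ↦ f.toAlternatingMap.map_perm x σ
  -- the other enumeration of `ι`, `a` first
  let e' : Fin (a + b) ≃ ι := (finCongr (Nat.add_comm a b)).trans e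
  -- (1) `vol(Φw ⊔ Φu) = sign_Z · sign_Y · #(Z ∩ Y)` (Bézout for the complementary complex subtori `Z`, `Y`)
  have hvol : volumeForm Φ e (latticeTuple Φ (Fin.append w u)) =
      ((orientationSign (subtorusPeriod Φ (orthSubspace Φ η V) hW hWc) eW * orientationSign (subtorusPeriod Φ V hV hVc) eV *
        (Nat.card ↥(subtorus Φ (orthSubspace Φ η V) ⊓ subtorus Φ V) : ℤ) : ℤ) : ℂ) := by
    rw [← torusIntegral_cycleFormOfFrame_wedge_cycleFormOfFrame Φ e e' w u]
    exact torusIntegral_cycleForm_wedge_cycleForm_eq_sign_mul_natCard Φ hW hWc hV hVc e e' eW eV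
  -- (2) `#K(ι_Y^*L) = #(Z ∩ Y) · #(K(L) ∩ Y)` ((2.17)) and `#(Z ∩ Y) ≥ 1`
  have hcard : Nat.card (subK Φ η V) =
      Nat.card ↥(subtorus Φ (orthSubspace Φ η V) ⊓ subtorus Φ V) * Nat.card ↥(kerPhiH Φ G ⊓ subtorus Φ V) :=
    natCard_subK_eq_mul Φ hη hG hW hWc hV hVc (isCompl_orthSubspace Φ hη hVc).symm
      fun _ hv _ hw' ↦ by rw [twoForm_swap, (mem_orthSubspace_iff Φ η).1 hv _ hw', neg_zero]
  have hpos : 1 ≤ Nat.card ↥(subtorus Φ (orthSubspace Φ η V) ⊓ subtorus Φ V) :=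
    one_le_natCard_inf_subtorus Φ hW hWc hV hVc (isCompl_orthSubspace Φ hη hVc).symm
  -- (3) hence `Φw ⊔ Φu` is a real basis of `E`
  have hne : (latticeBasis Φ e).det (latticeTuple Φ (Fin.append w u)) ≠ 0 := by
    intro h0
    have h1 := hvol
    rw [volumeForm_apply, h0, mul_zero, Complex.ofReal_zero] at h1
    have h2 : (orientationSign (subtorusPeriod Φ (orthSubspace Φ η V) hW hWc) eW *
        orientationSign (subtorusPeriod Φ V hV hVc) eV *
        (Nat.card ↥(subtorus Φ (orthSubspace Φ η V) ⊓ subtorus Φ V) : ℤ) : ℤ) = 0 := by exact_mod_cast h1.symm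
    rcases orientationSign_eq_or (subtorusPeriod Φ (orthSubspace Φ η V) hW hWc) eW with hs | hs <;>
      rcases orientationSign_eq_or (subtorusPeriod Φ V hV hVc) eV with hs' | hs' <;>
      · rw [hs, hs'] at h2; omega
  obtain ⟨hli, hsp⟩ := (latticeBasis Φ e).is_basis_iff_det.2 (isUnit_iff_ne_zero.2 hne)
  let β : Basis (Fin (b + a)) ℝ E := Basis.mk hli hsp.ge
  let β' : Basis (Fin b ⊕ Fin a) ℝ E := β.reindex finSumFinEquiv.symm
  have hβl : ∀ j, β' (Sum.inl j) = latticeVec Φ (w j) := fun j ↦ by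
    simp only [β', β, Basis.reindex_apply, Equiv.symm_symm, finSumFinEquiv_apply_left, Basis.mk_apply,
      latticeTuple_apply, Fin.append_left]
  have hβr : ∀ i, β' (Sum.inr i) = latticeVec Φ (u i) := fun i ↦ by
    simp only [β', β, Basis.reindex_apply, Equiv.symm_symm, finSumFinEquiv_apply_right, Basis.mk_apply,
      latticeTuple_apply, Fin.append_right]
  -- (4) the key value: both sides agree on `Φu`
  have hdet : (Matrix.of fun i j ↦ η ![latticeVec Φ (u i), latticeTuple Φ u j]).det = (Nat.card (subK Φ η V) : ℝ) := by
    simp only [latticeTuple_apply, hudef]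
    exact hη.det_gram_adaptedBasis_eq_natCard_subK Φ hV hVc eV
  have key : ((Nat.card ↥(kerPhiH Φ G ⊓ subtorus Φ V) : ℂ) • cycleFormOfFrame Φ e w) (latticeTuple Φ u) =
      ((((orientationSign (subtorusPeriod Φ (orthSubspace Φ η V) hW hWc) eW *
          orientationSign (subtorusPeriod Φ V hV hVc) eV : ℤ) : ℂ)) • polFlat Φ η a (exteriorPower.ιMulti ℤ a u))
        (latticeTuple Φ u) := by
    rw [ContinuousAlternatingMap.smul_apply, ContinuousAlternatingMap.smul_apply, cycleFormOfFrame_apply,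
      append_latticeTuple, hvol, polFlat_ιMulti_apply, hdet, hcard, smul_eq_mul, smul_eq_mul]
    push_cast
    ring
  -- (5) compare on all sub-families of the basis `β'`
  refine ContinuousAlternatingMap.toAlternatingMap_injective (β'.ext_alternating fun v hv ↦ ?_)
  simp only [ContinuousAlternatingMap.coe_toAlternatingMap]
  by_cases hall : ∀ i, ∃ k, v i = Sum.inr k
  · -- all entries from `Φu`: a permutation of `Φu`
    choose τ hτ using hall
    have hτ' : Function.Injective τ := fun i j h ↦ hv (by rw [hτ i, hτ j, h])
    let σ : Equiv.Perm (Fin a) := Equiv.ofBijective τ (Finite.injective_iff_bijective.1 hτ')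
    have hvσ : (fun i ↦ β' (v i)) = latticeTuple Φ u ∘ σ := funext fun i ↦ by
      rw [hτ i, hβr, Function.comp_apply, latticeTuple_apply]
      rfl
    rw [hvσ, hperm, hperm, key]
  · -- some entry `Φwⱼ`: both sides vanish
    push Not at hall
    obtain ⟨i, hi⟩ := hall
    obtain ⟨j, hj⟩ : ∃ j, v i = Sum.inl j := by
      cases h : v i with
      | inl j => exact ⟨j, rfl⟩
      | inr k => exact absurd h (hi k)
    have hL : cycleFormOfFrame Φ e w (fun i ↦ β' (v i)) = 0 := by
      rw [cycleFormOfFrame_apply]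
      refine (volumeForm Φ e).map_eq_zero_of_eq _ (i := Fin.castAdd a j) (j := Fin.natAdd b i) ?_ ?_
      · rw [Fin.append_left, Fin.append_right, hj, hβl, latticeTuple_apply]
      · intro h
        have h' := congrArg Fin.val h
        simp only [Fin.val_castAdd, Fin.val_natAdd] at h'
        omega
    have hR : polFlat Φ η a (exteriorPower.ιMulti ℤ a u) (fun i ↦ β' (v i)) = 0 :=
      polFlat_ιMulti_apply_eq_zero_of_column Φ η u _ i fun k ↦ by
        rw [hj, hβl]
        exact (mem_orthSubspace_iff Φ η).1 (hw j) _ (hu k)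
    rw [ContinuousAlternatingMap.smul_apply, hL, ContinuousAlternatingMap.smul_apply, hR, smul_zero, smul_zero]

/-- **`η♭([Y]) = ± |K(λ) ∩ Y| · cl(Y^⊥)`** (the duality theorem solved for `η♭([Y])`; the sign squares to `1`).
[cite: Bertrand1997DualityTori, §3 (a) Thm. 3 (i), proof (p. 212: "the cycle associated to `B′` is equal to `|K(λ)|/|B^⊥ ∩ K(λ)|` times that of `B^⊥`")] -/
theorem IsRiemannForm.polFlat_eq_smul_cycleFormOfFrame_orthSubspace (hη : IsRiemannForm Φ η)
    (hG : G.map (Int.cast : ℤ → ℝ) = latticeGram Φ η) (hV : IsLatticeSubspace V) (hVc : IsComplexSubspace Φ V)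
    (hW : IsLatticeSubspace (orthSubspace Φ η V)) (hWc : IsComplexSubspace Φ (orthSubspace Φ η V))
    (e : Fin (b + a) ≃ ι) (eV : Fin a ≃ Fin (subRank V)) (eW : Fin b ≃ Fin (subRank (orthSubspace Φ η V))) :
    polFlat Φ η a (exteriorPower.ιMulti ℤ a fun i ↦ adaptedBasis V (adaptedEmb V (eV i))) =
      ((orientationSign (subtorusPeriod Φ (orthSubspace Φ η V) hW hWc) eW *
          orientationSign (subtorusPeriod Φ V hV hVc) eV * (Nat.card ↥(kerPhiH Φ G ⊓ subtorus Φ V) : ℤ) : ℤ) : ℂ) •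
        cycleFormOfFrame Φ e (fun j ↦ adaptedBasis (orthSubspace Φ η V) (adaptedEmb _ (eW j))) := by
  have hs : (orientationSign (subtorusPeriod Φ (orthSubspace Φ η V) hW hWc) eW *
      orientationSign (subtorusPeriod Φ V hV hVc) eV) *
      (orientationSign (subtorusPeriod Φ (orthSubspace Φ η V) hW hWc) eW *
        orientationSign (subtorusPeriod Φ V hV hVc) eV) = 1 := by
    have h1 := orientationSign_mul_self (subtorusPeriod Φ (orthSubspace Φ η V) hW hWc) eW
    have h2 := orientationSign_mul_self (subtorusPeriod Φ V hV hVc) eV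
    linear_combination (orientationSign (subtorusPeriod Φ V hV hVc) eV * orientationSign (subtorusPeriod Φ V hV hVc) eV) * h1 + h2
  have h := congrArg (fun x ↦ ((orientationSign (subtorusPeriod Φ (orthSubspace Φ η V) hW hWc) eW *
      orientationSign (subtorusPeriod Φ V hV hVc) eV : ℤ) : ℂ) • x)
    (hη.natCard_smul_cycleFormOfFrame_orthSubspace_eq_smul_polFlat Φ hG hV hVc hW hWc e eV eW)
  simp only [smul_smul] at h
  rw [← Int.cast_mul, hs, Int.cast_one, one_smul] at h
  rw [← h]
  congr 1
  push_cast
  ring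

/-- **`η♭([Y]) = |K(λ) ∩ Y| · cl(Y^⊥)` ON THE NOSE for complex orientations** (positively oriented enumerations
`eV`, `eW`; they exist, tree `exists_orientationSign_subtorusPeriod_eq_one`).
[cite: Bertrand1997DualityTori, §3 (a) Thm. 3 (i), proof (p. 212)] -/
theorem IsRiemannForm.polFlat_eq_natCard_smul_cycleFormOfFrame_orthSubspace (hη : IsRiemannForm Φ η)
    (hG : G.map (Int.cast : ℤ → ℝ) = latticeGram Φ η) (hV : IsLatticeSubspace V) (hVc : IsComplexSubspace Φ V)
    (hW : IsLatticeSubspace (orthSubspace Φ η V)) (hWc : IsComplexSubspace Φ (orthSubspace Φ η V))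
    (e : Fin (b + a) ≃ ι) {eV : Fin a ≃ Fin (subRank V)} (hposV : orientationSign (subtorusPeriod Φ V hV hVc) eV = 1)
    {eW : Fin b ≃ Fin (subRank (orthSubspace Φ η V))}
    (hposW : orientationSign (subtorusPeriod Φ (orthSubspace Φ η V) hW hWc) eW = 1) :
    polFlat Φ η a (exteriorPower.ιMulti ℤ a fun i ↦ adaptedBasis V (adaptedEmb V (eV i))) =
      (Nat.card ↥(kerPhiH Φ G ⊓ subtorus Φ V) : ℂ) •
        cycleFormOfFrame Φ e (fun j ↦ adaptedBasis (orthSubspace Φ η V) (adaptedEmb _ (eW j))) := by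
  rw [hη.polFlat_eq_smul_cycleFormOfFrame_orthSubspace Φ hG hV hVc hW hWc e eV eW, hposV, hposW, one_mul, one_mul,
    Int.cast_natCast]

/-- **The duality theorem for a pair `(V, W)` with `W = V^⊥`** (the form in which it applies to both members of a
complementary pair). [cite: Bertrand1997DualityTori, §1 (b) Prop. 1 (i) (pp. 200–201) and §3 (a) Thm. 3 (i) (p. 212)] -/
theorem IsRiemannForm.natCard_smul_cycleFormOfFrame_eq_smul_polFlat_of_orthSubspace_eq {W : Submodule ℝ (ι → ℝ)}
    (hη : IsRiemannForm Φ η) (hG : G.map (Int.cast : ℤ → ℝ) = latticeGram Φ η) (hWV : orthSubspace Φ η V = W)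
    (hV : IsLatticeSubspace V) (hVc : IsComplexSubspace Φ V) (hW : IsLatticeSubspace W) (hWc : IsComplexSubspace Φ W)
    (e : Fin (b + a) ≃ ι) (eV : Fin a ≃ Fin (subRank V)) (eW : Fin b ≃ Fin (subRank W)) :
    (Nat.card ↥(kerPhiH Φ G ⊓ subtorus Φ V) : ℂ) • cycleFormOfFrame Φ e (fun j ↦ adaptedBasis W (adaptedEmb W (eW j))) =
      ((orientationSign (subtorusPeriod Φ W hW hWc) eW * orientationSign (subtorusPeriod Φ V hV hVc) eV : ℤ) : ℂ) •
        polFlat Φ η a (exteriorPower.ιMulti ℤ a fun i ↦ adaptedBasis V (adaptedEmb V (eV i))) := by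
  subst hWV
  exact hη.natCard_smul_cycleFormOfFrame_orthSubspace_eq_smul_polFlat Φ hG hV hVc hW hWc e eV eW

/-- **The symmetric statement `|K(λ) ∩ Y^⊥| · cl(Y) = ± η♭([Y^⊥])`** (`(V^⊥)^⊥ = V`).
[cite: Bertrand1997DualityTori, §1 (b) Prop. 1 (i) (pp. 200–201: both factorizations of `[L^* : M ⊕ M^⊥]`) and §3 (a) Thm. 3 (i) (p. 212)] -/
theorem IsRiemannForm.natCard_smul_cycleFormOfFrame_eq_smul_polFlat_orthSubspace (hη : IsRiemannForm Φ η)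
    (hG : G.map (Int.cast : ℤ → ℝ) = latticeGram Φ η) (hV : IsLatticeSubspace V) (hVc : IsComplexSubspace Φ V)
    (hW : IsLatticeSubspace (orthSubspace Φ η V)) (hWc : IsComplexSubspace Φ (orthSubspace Φ η V))
    (e' : Fin (a + b) ≃ ι) (eV : Fin a ≃ Fin (subRank V)) (eW : Fin b ≃ Fin (subRank (orthSubspace Φ η V))) :
    (Nat.card ↥(kerPhiH Φ G ⊓ subtorus Φ (orthSubspace Φ η V)) : ℂ) •
        cycleFormOfFrame Φ e' (fun i ↦ adaptedBasis V (adaptedEmb V (eV i))) =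
      ((orientationSign (subtorusPeriod Φ V hV hVc) eV *
          orientationSign (subtorusPeriod Φ (orthSubspace Φ η V) hW hWc) eW : ℤ) : ℂ) •
        polFlat Φ η b (exteriorPower.ιMulti ℤ b fun j ↦ adaptedBasis (orthSubspace Φ η V) (adaptedEmb _ (eW j))) :=
  hη.natCard_smul_cycleFormOfFrame_eq_smul_polFlat_of_orthSubspace_eq Φ hG (orthSubspace_orthSubspace Φ hη hVc) hW hWc
    hV hVc e' eW eV

end Duality

/-! ## §2 Arbitrary subtorus data; integrals `∫_X θ ∧ η♭([Y]) = |K(λ) ∩ Y| · ∫_{Y^⊥} θ` -/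

section Consequences

variable {ι : Type*} [Fintype ι] [DecidableEq ι] {E : Type*} [NormedAddCommGroup E] [NormedSpace ℂ E]
  (Φ : (ι → ℝ) ≃L[ℝ] E) {η : E [⋀^Fin 2]→L[ℝ] ℝ} {G : Matrix ι ι ℤ} {V : Submodule ℝ (ι → ℝ)} {a b : ℕ}

omit [DecidableEq ι] in
/-- A subtorus datum with real span `ΦV` has `rk(Λ ∩ V)` frame vectors. [cite: Lange2023AbelianVarietiesComplex, §1.1.6 Exercise (2)(a) (p. 26)] -/
private theorem frameCard_eq_subRank_of_realSpan_eq (hV : IsLatticeSubspace V) {M : ℕ} (Y' : SubtorusFrame Φ M)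
    (hY' : Y'.realSpan = V.map (Φ : (ι → ℝ) →ₗ[ℝ] E)) : M = subRank V := by
  rw [← finrank_eq_subRank hV, (Submodule.equivMapOfInjective (Φ : (ι → ℝ) →ₗ[ℝ] E) Φ.injective V).finrank_eq,
    ← hY', SubtorusFrame.realSpan, finrank_span_eq_card Y'.linearIndependent, Fintype.card_fin]

/-- **`η♭([Y]) = |K(λ) ∩ Y| · cl(Y^⊥)` for ARBITRARY subtorus data** presenting `Y = π(ΦV)` and `Y^⊥ = π(ΦV^⊥)`
(any saturated positively oriented `ℤ`-bases with the right real spans; no sign, no enumeration).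
[cite: Bertrand1997DualityTori, §3 (a) Thm. 3 (i), proof (p. 212) and §1 (b) Prop. 1 (i) (pp. 200–201)] -/
theorem IsRiemannForm.polFlat_eq_natCard_smul_cycleForm_of_realSpan_eq (hη : IsRiemannForm Φ η)
    (hG : G.map (Int.cast : ℤ → ℝ) = latticeGram Φ η) (hV : IsLatticeSubspace V) (hVc : IsComplexSubspace Φ V)
    (Y' : SubtorusFrame Φ a) (hY' : Y'.realSpan = V.map (Φ : (ι → ℝ) →ₗ[ℝ] E)) (Z' : SubtorusFrame Φ b)
    (hZ' : Z'.realSpan = (orthSubspace Φ η V).map (Φ : (ι → ℝ) →ₗ[ℝ] E)) (e : Fin (b + a) ≃ ι) :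
    polFlat Φ η a (exteriorPower.ιMulti ℤ a Y'.frame) = (Nat.card ↥(kerPhiH Φ G ⊓ subtorus Φ V) : ℂ) • Z'.cycleForm e := by
  have hW : IsLatticeSubspace (orthSubspace Φ η V) := isLatticeSubspace_orthSubspace Φ hη hV hVc
  have hWc : IsComplexSubspace Φ (orthSubspace Φ η V) := isComplexSubspace_orthSubspace Φ hη.1 hVc
  obtain rfl := frameCard_eq_subRank_of_realSpan_eq Φ hV Y' hY'
  obtain rfl := frameCard_eq_subRank_of_realSpan_eq Φ hW Z' hZ'
  obtain ⟨eV, hposV⟩ := exists_orientationSign_subtorusPeriod_eq_one Φ V hV hVc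
  obtain ⟨eW, hposW⟩ := exists_orientationSign_subtorusPeriod_eq_one Φ (orthSubspace Φ η V) hW hWc
  rw [SubtorusFrame.cycleForm_eq_of_realSpan_eq Z' (SubtorusFrame.ofSubspace Φ _ hW hWc eW hposW)
      (by rw [hZ', SubtorusFrame.realSpan_ofSubspace]) e,
    Y'.ιMulti_frame_eq_of_realSpan_eq Φ (SubtorusFrame.ofSubspace Φ V hV hVc eV hposV)
      (by rw [hY', SubtorusFrame.realSpan_ofSubspace])]
  exact hη.polFlat_eq_natCard_smul_cycleFormOfFrame_orthSubspace Φ hG hV hVc hW hWc e hposV hposW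

/-- **`∫_X θ ∧ η♭([Y]) = ± |K(λ) ∩ Y| · ∫_{Y^⊥} θ`** for every invariant `b`-form `θ` (`∫_{Z_w} θ = θ(Φw)`):
integrating against `η♭([Y])` is `|K(λ) ∩ Y|` times restriction to the complementary sub-torus.
[cite: Bertrand1997DualityTori, §3 (a) Thm. 3 (i) (p. 212)] [cite: Lange2023AbelianVarietiesComplex, §2.5.3 Lemma 2.5.14] -/
theorem IsRiemannForm.torusIntegral_wedge_polFlat (hη : IsRiemannForm Φ η)
    (hG : G.map (Int.cast : ℤ → ℝ) = latticeGram Φ η) (hV : IsLatticeSubspace V) (hVc : IsComplexSubspace Φ V)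
    (hW : IsLatticeSubspace (orthSubspace Φ η V)) (hWc : IsComplexSubspace Φ (orthSubspace Φ η V))
    (e : Fin (b + a) ≃ ι) (eV : Fin a ≃ Fin (subRank V)) (eW : Fin b ≃ Fin (subRank (orthSubspace Φ η V)))
    (θ : E [⋀^Fin b]→L[ℝ] ℂ) :
    torusIntegral Φ e (θ.wedge (polFlat Φ η a (exteriorPower.ιMulti ℤ a fun i ↦ adaptedBasis V (adaptedEmb V (eV i))))) =
      ((orientationSign (subtorusPeriod Φ (orthSubspace Φ η V) hW hWc) eW *
          orientationSign (subtorusPeriod Φ V hV hVc) eV * (Nat.card ↥(kerPhiH Φ G ⊓ subtorus Φ V) : ℤ) : ℤ) : ℂ) *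
        θ (latticeTuple Φ fun j ↦ adaptedBasis (orthSubspace Φ η V) (adaptedEmb _ (eW j))) := by
  rw [hη.polFlat_eq_smul_cycleFormOfFrame_orthSubspace Φ hG hV hVc hW hWc e eV eW, wedge_smul_right_complex,
    torusIntegral_smul, torusIntegral_wedge_cycleFormOfFrame]

/-- **`∫_X θ ∧ η♭([Y]) = |K(λ) ∩ Y| · ∫_{[Y^⊥]} θ`** with complex orientations (`[Y^⊥] = w₀ ⋆ ⋯ ⋆ w_{b-1}`, tree
`cycleIntegral`). [cite: Bertrand1997DualityTori, §3 (a) Thm. 3 (i) (p. 212)] [cite: Lange2023AbelianVarietiesComplex, §2.5.3 Lemma 2.5.12 / 2.5.14] -/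
theorem IsRiemannForm.torusIntegral_wedge_polFlat_eq_natCard_mul_cycleIntegral (hη : IsRiemannForm Φ η)
    (hG : G.map (Int.cast : ℤ → ℝ) = latticeGram Φ η) (hV : IsLatticeSubspace V) (hVc : IsComplexSubspace Φ V)
    (hW : IsLatticeSubspace (orthSubspace Φ η V)) (hWc : IsComplexSubspace Φ (orthSubspace Φ η V))
    (e : Fin (b + a) ≃ ι) {eV : Fin a ≃ Fin (subRank V)} (hposV : orientationSign (subtorusPeriod Φ V hV hVc) eV = 1)
    {eW : Fin b ≃ Fin (subRank (orthSubspace Φ η V))}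
    (hposW : orientationSign (subtorusPeriod Φ (orthSubspace Φ η V) hW hWc) eW = 1) (θ : E [⋀^Fin b]→L[ℝ] ℂ) :
    torusIntegral Φ e (θ.wedge (polFlat Φ η a (exteriorPower.ιMulti ℤ a fun i ↦ adaptedBasis V (adaptedEmb V (eV i))))) =
      (Nat.card ↥(kerPhiH Φ G ⊓ subtorus Φ V) : ℂ) *
        cycleIntegral Φ b (exteriorPower.ιMulti ℤ b fun j ↦ adaptedBasis (orthSubspace Φ η V) (adaptedEmb _ (eW j))) θ := by
  rw [hη.torusIntegral_wedge_polFlat Φ hG hV hVc hW hWc e eV eW, hposV, hposW, one_mul, one_mul, Int.cast_natCast,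
    cycleIntegral_ιMulti]

/-- **`∫_X θ ∧ η♭([Y]) = |K(λ) ∩ Y| · ∫_X θ ∧ cl(Y^⊥)`** for arbitrary subtorus data presenting `Y`, `Y^⊥`.
[cite: Bertrand1997DualityTori, §3 (a) Thm. 3 (i) (p. 212)] -/
theorem IsRiemannForm.torusIntegral_wedge_polFlat_of_realSpan_eq (hη : IsRiemannForm Φ η)
    (hG : G.map (Int.cast : ℤ → ℝ) = latticeGram Φ η) (hV : IsLatticeSubspace V) (hVc : IsComplexSubspace Φ V)
    (Y' : SubtorusFrame Φ a) (hY' : Y'.realSpan = V.map (Φ : (ι → ℝ) →ₗ[ℝ] E)) (Z' : SubtorusFrame Φ b)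
    (hZ' : Z'.realSpan = (orthSubspace Φ η V).map (Φ : (ι → ℝ) →ₗ[ℝ] E)) (e : Fin (b + a) ≃ ι)
    (θ : E [⋀^Fin b]→L[ℝ] ℂ) :
    torusIntegral Φ e (θ.wedge (polFlat Φ η a (exteriorPower.ιMulti ℤ a Y'.frame))) =
      (Nat.card ↥(kerPhiH Φ G ⊓ subtorus Φ V) : ℂ) * torusIntegral Φ e (θ.wedge (Z'.cycleForm e)) := by
  rw [hη.polFlat_eq_natCard_smul_cycleForm_of_realSpan_eq Φ hG hV hVc Y' hY' Z' hZ' e, wedge_smul_right_complex,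
    torusIntegral_smul]

/-- **The principal case has multiplicity one**: for a principal polarisation `K(λ) = 0`, so `|K(λ) ∩ Y| = 1` and §1
is the tree's `IsPrincipalPolarization.cycleFormOfFrame_orthSubspace_eq_smul_polFlat` (`cl(Y^⊥) = ± η♭([Y])`).
[cite: Bertrand1997DualityTori, §3 (a) Thm. 3 (p. 212: "When `λ` is a principal polarisation, that is, when the kernel `K(λ)` of `φ` is trivial …")] -/
theorem IsPrincipalPolarization.natCard_kerPhiH_inf_subtorus_eq_one (hp : IsPrincipalPolarization Φ η)
    (hG : G.map (Int.cast : ℤ → ℝ) = latticeGram Φ η) : Nat.card ↥(kerPhiH Φ G ⊓ subtorus Φ V) = 1 := by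
  obtain ⟨G', hG', hcard⟩ := hp.exists_natCard_kerPhiH_eq_one
  have hGG' : G = G' := by
    have h : G.map (Int.cast : ℤ → ℝ) = G'.map (Int.cast : ℤ → ℝ) := by rw [hG, hG']
    exact Matrix.ext fun i j ↦ Int.cast_injective (α := ℝ) (congrFun (congrFun h i) j)
  subst hGG'
  haveI : Finite (kerPhiH Φ G) := Nat.finite_of_card_ne_zero (by rw [hcard]; exact one_ne_zero)
  have hbot : kerPhiH Φ G = ⊥ := (AddSubgroup.eq_bot_iff_card _).2 hcard
  rw [hbot, bot_inf_eq, AddSubgroup.card_bot]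

end Consequences

/-! ## §3 With the complementary multidegrees of gen 15: `J! · |K(λ) ∩ B| · deg_{J′}(B^⊥) = (d₁⋯d_g) · J′! · deg_J(B)` for every type -/

section Multidegrees

universe uE

variable {ι : Type*} [Fintype ι] [LinearOrder ι] {E : Type uE} [NormedAddCommGroup E] [NormedSpace ℂ E]
  (Φ : (ι → ℝ) ≃L[ℝ] E) {g : ℕ} {e₀ : Fin g ⊕ Fin g ≃ ι} {η : E [⋀^Fin 2]→L[ℝ] ℝ} {d : Fin g → ℕ} {G : Matrix ι ι ℤ}
  {β : Type*} [Fintype β] [DecidableEq β] {p q : ℕ} {V : Submodule ℝ (ι → ℝ)}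

/-- **Complementary multidegrees of orthogonal abelian subvarieties for an ARBITRARY polarisation type**:
for a polarised torus with a symplectic basis of type `(d₁, …, d_g)` split into blocks (`blk : Fin g → β`; block
forms `θ_i`, `ch_i = -θ_i`), complementary words `c : Fin q → β`, `c′ : Fin p → β` (`r_i(c) + r_i(c′) = #blk⁻¹ i`,
`q + p = g`), a complex sub-torus `B = π(V)` presented by a subtorus datum `Y′ : SubtorusFrame Φ (2q)` and
`B^⊥ = π(V^⊥)` presented by `Z′ : SubtorusFrame Φ (2p)`:
`J! · |K(λ) ∩ B| · ∫_X ch^{J′} ∧ cl(B^⊥) = (d₁⋯d_g) · J′! · ∫_X ch^{J} ∧ cl(B)` — the form identity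
`J! ∫_X ch^{J′} ∧ η♭(σ) = (d₁⋯d_g) J′! ∫_σ ch^{J}` of `ComplexTorusComplementaryMultidegrees`
(`IsSymplecticEnum.prod_factorial_mul_torusIntegral_chern_wedge_polFlat`, every `σ ∈ H_{2q}(X, ℤ)`) at `σ = [B]`,
with §2's `η♭([B]) = |K(λ) ∩ B| · cl(B^⊥)`.  For ONE block (`β = Unit`, `J = (q)`, `J′ = (p)`) this is Bertrand's
Thm. 3 (ii) degree formula `deg_λ(B^⊥) = (b′!/a!b!) deg_λ(B) deg_λ(A)/|B ∩ K(λ)|` with `deg_λ(A) = a!·(d₁⋯d_g)`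
(tree `IsRiemannForm.degree_orthSubspace_eq`, p10); for a principal `λ` (`dᵢ = 1`, `K(λ) = 0`) it is the COROLLARY of
§3 (b) (`ComplexTorusComplementaryMultidegreesSubvarieties`).
[cite: Bertrand1997DualityTori, §3 (a) Thm. 3 (i)–(ii) (p. 212) and §3 (b) Corollary (p. 214)] -/
theorem IsSymplecticEnum.prod_factorial_mul_natCard_mul_torusIntegral_chern_wedge_cycleForm_orthSubspace
    (hs : IsSymplecticEnum Φ e₀ η d) (hη : IsRiemannForm Φ η) (hG : G.map (Int.cast : ℤ → ℝ) = latticeGram Φ η)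
    (hm : q + p = g) (blk : Fin g → β) {c : Fin q → β} {c' : Fin p → β}
    (hcc' : ∀ i, wordMult c i + wordMult c' i = (Finset.univ.filter fun ν ↦ blk ν = i).card)
    (hV : IsLatticeSubspace V) (hVc : IsComplexSubspace Φ V) (Y' : SubtorusFrame Φ (2 * q))
    (hY' : Y'.realSpan = V.map (Φ : (ι → ℝ) →ₗ[ℝ] E)) (Z' : SubtorusFrame Φ (2 * p))
    (hZ' : Z'.realSpan = (orthSubspace Φ η V).map (Φ : (ι → ℝ) →ₗ[ℝ] E)) (e : Fin (2 * p + 2 * q) ≃ ι)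
    (e' : Fin (2 * q + 2 * p) ≃ ι) :
    (∏ i, ((wordMult c i).factorial : ℂ)) * (Nat.card ↥(kerPhiH Φ G ⊓ subtorus Φ V) : ℂ) *
        torusIntegral Φ e ((wedgeFamily p fun j ↦ -blockTwoForm Φ e₀ d blk (c' j)).wedge (Z'.cycleForm e)) =
      (∏ i, (d i : ℂ)) * (∏ i, ((wordMult c' i).factorial : ℂ)) *
        torusIntegral Φ e' ((wedgeFamily q fun j ↦ -blockTwoForm Φ e₀ d blk (c j)).wedge (Y'.cycleForm e')) := by
  have hm' : q + p = Fintype.card (Fin g) := by rw [Fintype.card_fin]; exact hm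
  have h := hs.prod_factorial_mul_torusIntegral_chern_wedge_polFlat Φ hη hG hm' e blk hcc'
    (exteriorPower.ιMulti ℤ (2 * q) Y'.frame)
  rw [hη.torusIntegral_wedge_polFlat_of_realSpan_eq Φ hG hV hVc Y' hY' Z' hZ' e, cycleIntegral_ιMulti,
    ← SubtorusFrame.torusIntegral_wedge_cycleForm Y' e'] at h
  rw [mul_assoc]
  exact h

end Multidegrees

end ComplexTorus

end Literature.Geometry.Kaehler
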